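import Literature.MathematicalPhysics.QuantumFieldTheory.Balaban1983to89.B9SectBKerFrameCodedY
import Literature.MathematicalPhysics.QuantumFieldTheory.Balaban1983to89.B9Thm311PosAtRecordV4

/-!
# Balaban [B9], Thm 3.2 (3.48) p. 398 + (3.65)–(3.67) p. 403 + Thm 3.11 p. 416 — THE C⁻¹ MEMBER OF THE SECT.-B STEP OF RECORD (R13-U1) AT THE RECORD's
# TRANSPORTERS `parSymY`: the reversal law discharged (`Node00.parSymY_inv_symm`), and — for the matrix algebra with `G ≦ U(N)` — the invertibility of
# `(Q′G′²Q′*)(U)` discharged (`B9Thm311PosAtRecordV4.isUnit_XY_parSymY`): ★★ `stepKerPos_KSCU_parSymY_on`, ★★★ `stepKerPos_KSCU_parSymY_unitary_on`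

T. Bałaban, *Propagators for lattice gauge theories in a background field*, Commun. Math. Phys. **99** (1985) 389–434
[`Balaban1985BackgroundPropagators`, "B9"]; [4] = T. Bałaban, *Propagators and renormalization transformations for lattice gauge
theories. II*, Commun. Math. Phys. **96** (1984) 223–250 [`Balaban1984PropagatorsII`].

statement-level skeleton of published theorems with citation tags; proofs where landed; nothing here is a claim about the
Yang–Mills mass gap

WHAT.  `B9SectBKerFrameCodedY.stepKerPos_KSCU_on` (the (3.48) member of `B9SectBCodedReadingsU.SectBStepU` for a general transporter table `par`) displays,
beyond the binders of `B9SectBStepsKSCUBlocks.stepEPos_KSCU_on`, two print-intrinsic laws: `hunitX` (`(Q′G′²Q′*)(U)` is a unit at every `G`-valued `U` —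
Theorem 3.2 ∕ 3.11's regime) and the reversal law `hsym` (`U(Γ_{z,w}) = U(Γ_{w,z})⁻¹`).  At the record's transporters `parSymY` (the symmetrised gauge
transporter of node00-def-Y, `Node00.OpsYRecordV4`):
* ★★ `stepKerPos_KSCU_parSymY_on` — `hsym` discharged by `Node00.parSymY_inv_symm` (any complete normed `ℂ`-algebra `𝔸`; `hunitX` displayed);
* ★★★ `stepKerPos_KSCU_parSymY_unitary_on` — for `𝔸 = Matrix (Fin N) (Fin N) ℂ` (operator norm) and `G ≦ U(N)`, `hunitX` discharged as well by dag-n06's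
  `B9Thm311PosAtRecordV4.isUnit_XY_parSymY` (Theorem 3.11's positivity of `Q′G′²Q′*`): the (3.48) member of `SectBStepU` at the record's letters with EXACTLY the
  binders of `stepEPos_KSCU_on` plus `G ≦ U(N)`.

HONEST FRAMING.  Two specialisations; no analysis.  Count-neutral; no summit ∕ sub-problem statement is proved; N06 is not discharged by this file; nothing
continuum ∕ OS ∕ mass-gap ∕ Clay.  No `sorry`, no `axiom`, no `… : Prop` fact, no `instance`, no `notation`, no `def`.  Seat dag-n06-c g12, 2026-08-28;
`--supports stmt-QuantumFields-27364`.
-/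

noncomputable section

namespace Literature.MathematicalPhysics.QuantumFieldTheory.Balaban1983to89.B9SectBKerStepParSymY

open Literature.MathematicalPhysics.QuantumFieldTheory.Balaban1983to89.B6Ineq2142KLevelV1 (β)
open Literature.MathematicalPhysics.QuantumFieldTheory.Balaban1983to89.B9SectBCodedCarrier (pullS)
open Literature.MathematicalPhysics.QuantumFieldTheory.Balaban1983to89.B9Eq360DeltaPrimeAY (AfldY)
open Literature.MathematicalPhysics.QuantumFieldTheory.Balaban1983to89.B9PinMembersKLevelV1 (MemberY geo9Y bg9Y)
open Literature.MathematicalPhysics.QuantumFieldTheory.Balaban1983to89.B9SectBGpLettersY (GVal)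
open Literature.MathematicalPhysics.QuantumFieldTheory.Balaban1983to89.B9SectBGpFrameCodedY (codingYx CplxLettersY)
open Literature.MathematicalPhysics.QuantumFieldTheory.Balaban1983to89.B9SectBCodedReadingsU (KSCU KACU)
open Literature.MathematicalPhysics.QuantumFieldTheory.Balaban1983to89.B9SectBStepWhole (StepKerPos)
open Literature.MathematicalPhysics.QuantumFieldTheory.Balaban1983to89.B9SectBKerFrameCodedY (CinvY stepKerPos_KSCU_on)
open Literature.MathematicalPhysics.QuantumFieldTheory.Balaban1983to89.B9Thm311PosAtRecordV4 (isUnit_XY_parSymY)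
open Literature.MathematicalPhysics.QuantumFieldTheory.Balaban1983to89.Node00 (SiteY BlkY IBondY CfgY BondOpY BondParY GpY XY deltaPrimeAY parSymY
  parSymY_inv_symm)

variable {d ℓ : ℕ} {hd : 1 ≤ d + 1} {hL : Odd (ℓ + 1) ∧ 1 < ℓ + 1} {b₀ b₁ : ℝ} {Mstar : ℕ}

/-! ## §1 Any complete normed `ℂ`-algebra: the reversal law discharged -/

section General

variable {𝔸 : Type} [NormedRing 𝔸] [NormedAlgebra ℂ 𝔸] [CompleteSpace 𝔸] [NormOneClass 𝔸] [FiniteDimensional ℝ 𝔸]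
  {J : Type} (f : J → MemberY d ℓ hd hL b₀ b₁ Mstar) [∀ x : MemberY d ℓ hd hL b₀ b₁ Mstar, Fintype (geo9Y x).Site]
  [instDS : ∀ x : MemberY d ℓ hd hL b₀ b₁ Mstar, DecidableEq (geo9Y x).Site] [instNE : ∀ x : MemberY d ℓ hd hL b₀ b₁ Mstar, Nonempty (geo9Y x).Site]
  (c35 : ℝ) (G : Subgroup 𝔸ˣ) (OA : ∀ j : J, BondOpY 𝔸 (f j).toKIdx)
  (parB : ∀ j : J, BondParY 𝔸 (f j).toKIdx) {ι : Type} [Fintype ι] [DecidableEq ι] (b : Module.Basis ι ℝ 𝔸)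
  (ιB : ∀ j : J, BlkY (f j).toKIdx → IBondY (f j).toKIdx)
  (C37 C38 : ∀ j : J, ℝ → CfgY 𝔸 (f j).toKIdx → AfldY 𝔸 (f j).toKIdx → Prop)

/-- ★★ **THE (3.48) MEMBER OF `SectBStepU` AT THE RECORD's TRANSPORTERS `parSymY`**: `stepKerPos_KSCU_on` at `par := parSymY`, the reversal law supplied by
`Node00.parSymY_inv_symm`; displayed beyond `stepEPos_KSCU_on`'s binders: only `hunitX`. [cite: Balaban1985BackgroundPropagators, Thm 3.4 p.400, Thm 3.2 (3.48) p.398, (3.65)–(3.67) p.403, (3.40) p.397; Balaban1984PropagatorsII, Lemma 2.1 p.234, (2.51) p.232] -/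
theorem stepKerPos_KSCU_parSymY_on (hι : ∀ (j : J) (s : BlkY (f j).toKIdx), β (f j).toKIdx.hN (f j).toKIdx.D (f j).toKIdx.hk (ιB j s) = s)
    (hG1 : ∀ u : 𝔸ˣ, u ∈ G → ‖(u : 𝔸)‖ ≤ 1)
    (hpar : ∀ j (U : CfgY 𝔸 (f j).toKIdx), GVal G (f j).toKIdx U → ∀ z w, parSymY (f j).toKIdx U z w ∈ G)
    (hunit : ∀ j (U : CfgY 𝔸 (f j).toKIdx), GVal G (f j).toKIdx U → IsUnit (deltaPrimeAY (f j).toKIdx (parSymY (f j).toKIdx) U))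
    (M₂ : ℝ) (hM₂ : 0 ≤ M₂) (hrepr : ∀ (v : 𝔸) (j : ι), |b.repr v j| ≤ M₂ * ‖v‖) (hcR : 0 < M₂ * ∑ j, ‖b j‖)
    (Cq : ℝ) (hCq : 0 ≤ Cq)
    (hC37 : ∀ j β' U a, C37 j β' U a → GVal G (f j).toKIdx U ∧ CplxLettersY G (f j) (parSymY (f j).toKIdx) (ιB j) Cq β' U a)
    (MInv aInv aW : ℝ) (hMInv : 0 < MInv) (haInv : 0 < aInv) (haW : 0 < aW)
    (hunitX : ∀ j (U : CfgY 𝔸 (f j).toKIdx), GVal G (f j).toKIdx U →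
      IsUnit (XY (f j).toKIdx (parSymY (f j).toKIdx) (GpY (f j).toKIdx (parSymY (f j).toKIdx)) U)) :
    StepKerPos (d + 1) c35 (fun j => geo9Y (f j)) (fun j => (codingYx G (f j) (C37 j) (C38 j)).bg)
      (fun j => KSCU G (f j) (parSymY (f j).toKIdx) (C37 j) (C38 j)) (fun j => KACU G (f j) (OA j) (parB j) (C37 j) (C38 j))
      (fun j => pullS (codingYx G (f j) (C37 j) (C38 j)) (CinvY f G (fun j => parSymY (f j).toKIdx) j))
      (fun j => pullS (codingYx G (f j) (C37 j) (C38 j)) (CinvY f G (fun j => parSymY (f j).toKIdx) j)) :=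
  stepKerPos_KSCU_on f c35 G (fun j => parSymY (f j).toKIdx) OA parB b ιB C37 C38 hι hG1 hpar hunit M₂ hM₂ hrepr hcR Cq hCq hC37
    MInv aInv aW hMInv haInv haW hunitX (fun _ U z w => parSymY_inv_symm U z w)

end General

/-! ## §2 The matrix algebra with `G ≦ U(N)`: the invertibility of `(Q′G′²Q′*)(U)` discharged (Theorem 3.11) -/

section Unitary

open scoped Matrix.Norms.L2Operator

variable {N : ℕ} {J : Type} (f : J → MemberY d ℓ hd hL b₀ b₁ Mstar) [∀ x : MemberY d ℓ hd hL b₀ b₁ Mstar, Fintype (geo9Y x).Site]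
  [instDS : ∀ x : MemberY d ℓ hd hL b₀ b₁ Mstar, DecidableEq (geo9Y x).Site] [instNE : ∀ x : MemberY d ℓ hd hL b₀ b₁ Mstar, Nonempty (geo9Y x).Site]
  (c35 : ℝ) (G : Subgroup (Matrix (Fin N) (Fin N) ℂ)ˣ) (OA : ∀ j : J, BondOpY (Matrix (Fin N) (Fin N) ℂ) (f j).toKIdx)
  (parB : ∀ j : J, BondParY (Matrix (Fin N) (Fin N) ℂ) (f j).toKIdx) {ι : Type} [Fintype ι] [DecidableEq ι]
  (b : Module.Basis ι ℝ (Matrix (Fin N) (Fin N) ℂ))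
  (ιB : ∀ j : J, BlkY (f j).toKIdx → IBondY (f j).toKIdx)
  (C37 C38 : ∀ j : J, ℝ → CfgY (Matrix (Fin N) (Fin N) ℂ) (f j).toKIdx → AfldY (Matrix (Fin N) (Fin N) ℂ) (f j).toKIdx → Prop)

/-- ★★★ **THE (3.48) MEMBER OF `SectBStepU` AT THE RECORD's LETTERS, `G ≦ U(N)`**: `stepKerPos_KSCU_parSymY_on` with `hunitX` discharged by dag-n06's
`isUnit_XY_parSymY` — binders = those of `stepEPos_KSCU_on` (at `parSymY`) plus `G ≦ U(N)`. [cite: Balaban1985BackgroundPropagators, Thm 3.4 p.400, Thm 3.2 (3.48) p.398, (3.65)–(3.67) p.403, Thm 3.11 p.416, p.395; Balaban1984PropagatorsII, Lemma 2.1 p.234, (2.51) p.232] -/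
theorem stepKerPos_KSCU_parSymY_unitary_on [NormOneClass (Matrix (Fin N) (Fin N) ℂ)] [FiniteDimensional ℝ (Matrix (Fin N) (Fin N) ℂ)]
    (hG : G ≤ B7Prop2Explicit.unitaryUnits (Matrix (Fin N) (Fin N) ℂ))
    (hι : ∀ (j : J) (s : BlkY (f j).toKIdx), β (f j).toKIdx.hN (f j).toKIdx.D (f j).toKIdx.hk (ιB j s) = s)
    (hG1 : ∀ u : (Matrix (Fin N) (Fin N) ℂ)ˣ, u ∈ G → ‖(u : Matrix (Fin N) (Fin N) ℂ)‖ ≤ 1)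
    (hpar : ∀ j (U : CfgY (Matrix (Fin N) (Fin N) ℂ) (f j).toKIdx), GVal G (f j).toKIdx U → ∀ z w, parSymY (f j).toKIdx U z w ∈ G)
    (hunit : ∀ j (U : CfgY (Matrix (Fin N) (Fin N) ℂ) (f j).toKIdx), GVal G (f j).toKIdx U →
      IsUnit (deltaPrimeAY (f j).toKIdx (parSymY (f j).toKIdx) U))
    (M₂ : ℝ) (hM₂ : 0 ≤ M₂) (hrepr : ∀ (v : Matrix (Fin N) (Fin N) ℂ) (j : ι), |b.repr v j| ≤ M₂ * ‖v‖) (hcR : 0 < M₂ * ∑ j, ‖b j‖)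
    (Cq : ℝ) (hCq : 0 ≤ Cq)
    (hC37 : ∀ j β' U a, C37 j β' U a → GVal G (f j).toKIdx U ∧ CplxLettersY G (f j) (parSymY (f j).toKIdx) (ιB j) Cq β' U a)
    (MInv aInv aW : ℝ) (hMInv : 0 < MInv) (haInv : 0 < aInv) (haW : 0 < aW) :
    StepKerPos (d + 1) c35 (fun j => geo9Y (f j)) (fun j => (codingYx G (f j) (C37 j) (C38 j)).bg)
      (fun j => KSCU G (f j) (parSymY (f j).toKIdx) (C37 j) (C38 j)) (fun j => KACU G (f j) (OA j) (parB j) (C37 j) (C38 j))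
      (fun j => pullS (codingYx G (f j) (C37 j) (C38 j)) (CinvY f G (fun j => parSymY (f j).toKIdx) j))
      (fun j => pullS (codingYx G (f j) (C37 j) (C38 j)) (CinvY f G (fun j => parSymY (f j).toKIdx) j)) :=
  stepKerPos_KSCU_parSymY_on f c35 G OA parB b ιB C37 C38 hι hG1 hpar hunit M₂ hM₂ hrepr hcR Cq hCq hC37 MInv aInv aW hMInv haInv haW
    fun j _ hU => isUnit_XY_parSymY (f j).toKIdx hG hU

end Unitary

end Literature.MathematicalPhysics.QuantumFieldTheory.Balaban1983to89.B9SectBKerStepParSymY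

end
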